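import Mathlib
import HarnessLib
import Summits.MatrixMultiplication.MatrixMultiplication.Theorems.FarEdgeDescentCriterionCells

/-!
# Far-edge descent, kernel XLII-G — multi-affine box lemmas: an inequality affine in each variable holds on a box
# iff it holds at the vertices (model level, generic real analysis)

Every inequality a certification of `RegionCriterion` has to check on a cell (memo g62 §2.5: the endpoint
inequalities of `cell_bound`, the two conditions of `criterion_pair_of_strip_height`, the product-floor exclusion)
is MULTI-AFFINE in the cell variables `(λ, λ', V, V')` (and in the exponent parameter `κ`): affine in each variable
separately.  Such a function is bounded below on a box by its minimum over the `2^n` vertices.  THIS FILE proves the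
usable forms `box1`, `box2`, `box3`, `box4` (nonnegativity on `[a₀,a₁] × …` from nonnegativity at the vertices, the
affinity in each variable supplied as `∀ …, ∃ p q, ∀ t, f … t … = p + q·t`, which `ring` discharges via
`affine_witness`), so that a cell costs `2^n` closed rational checks and no nonlinear search.  Numerically (cert2.py,
memo g62 §2.5) the whole criterion at `β = 19/10` is decided by 185 such boxes (773 at `β = 8/5`).
No `sorry`, no new axioms, no definitions.
-/

noncomputable section

set_option linter.dupNamespace false

namespace Summit.MatrixMultiplication.MatrixMultiplication.Theorems.FarEdgeDescentBoxVertex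

/-- Affinity witness: if `f t = f 0 + (f 1 − f 0)·t` identically (a `ring` fact for an affine expression) then
`∃ p q, ∀ t, f t = p + q·t`. -/
theorem affine_witness {f : ℝ → ℝ} (h : ∀ t, f t = f 0 + (f 1 - f 0) * t) :
    ∃ p q : ℝ, ∀ t, f t = p + q * t :=
  ⟨f 0, f 1 - f 0, h⟩

/-- **One variable.**  An affine function nonnegative at `a₀` and `a₁` is nonnegative on `[a₀, a₁]`. -/
theorem box1 {f : ℝ → ℝ} (hf : ∃ p q : ℝ, ∀ t, f t = p + q * t) {a₀ a₁ : ℝ} (h0 : 0 ≤ f a₀)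
    (h1 : 0 ≤ f a₁) : ∀ a, a₀ ≤ a → a ≤ a₁ → 0 ≤ f a := by
  intro a ha0 ha1
  obtain ⟨p, q, hpq⟩ := hf
  rw [hpq] at h0 h1 ⊢
  rcases le_total 0 q with hq | hq
  · have : q * a₀ ≤ q * a := mul_le_mul_of_nonneg_left ha0 hq
    linarith
  · have : q * a₁ ≤ q * a := mul_le_mul_of_nonpos_left ha1 hq
    linarith

/-- **Two variables.**  `f` affine in each variable, nonnegative at the four vertices ⇒ nonnegative on the box. -/
theorem box2 {f : ℝ → ℝ → ℝ} (hf1 : ∀ b, ∃ p q : ℝ, ∀ t, f t b = p + q * t)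
    (hf2 : ∀ a, ∃ p q : ℝ, ∀ t, f a t = p + q * t) {a₀ a₁ b₀ b₁ : ℝ}
    (h00 : 0 ≤ f a₀ b₀) (h01 : 0 ≤ f a₀ b₁) (h10 : 0 ≤ f a₁ b₀) (h11 : 0 ≤ f a₁ b₁) :
    ∀ a b, a₀ ≤ a → a ≤ a₁ → b₀ ≤ b → b ≤ b₁ → 0 ≤ f a b := by
  intro a b ha0 ha1 hb0 hb1
  -- first along a at b = b₀ and b = b₁, then along b
  have hb₀ : 0 ≤ f a b₀ := box1 (hf1 b₀) h00 h10 a ha0 ha1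
  have hb₁ : 0 ≤ f a b₁ := box1 (hf1 b₁) h01 h11 a ha0 ha1
  exact box1 (hf2 a) hb₀ hb₁ b hb0 hb1

/-- **Three variables.** -/
theorem box3 {f : ℝ → ℝ → ℝ → ℝ} (hf1 : ∀ b c, ∃ p q : ℝ, ∀ t, f t b c = p + q * t)
    (hf2 : ∀ a c, ∃ p q : ℝ, ∀ t, f a t c = p + q * t)
    (hf3 : ∀ a b, ∃ p q : ℝ, ∀ t, f a b t = p + q * t) {a₀ a₁ b₀ b₁ c₀ c₁ : ℝ}
    (h000 : 0 ≤ f a₀ b₀ c₀) (h010 : 0 ≤ f a₀ b₁ c₀) (h100 : 0 ≤ f a₁ b₀ c₀) (h110 : 0 ≤ f a₁ b₁ c₀)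
    (h001 : 0 ≤ f a₀ b₀ c₁) (h011 : 0 ≤ f a₀ b₁ c₁) (h101 : 0 ≤ f a₁ b₀ c₁) (h111 : 0 ≤ f a₁ b₁ c₁) :
    ∀ a b c, a₀ ≤ a → a ≤ a₁ → b₀ ≤ b → b ≤ b₁ → c₀ ≤ c → c ≤ c₁ → 0 ≤ f a b c := by
  intro a b c ha0 ha1 hb0 hb1 hc0 hc1
  have hc₀ : 0 ≤ f a b c₀ :=
    box2 (fun b => hf1 b c₀) (fun a => hf2 a c₀) h000 h010 h100 h110 a b ha0 ha1 hb0 hb1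
  have hc₁ : 0 ≤ f a b c₁ :=
    box2 (fun b => hf1 b c₁) (fun a => hf2 a c₁) h001 h011 h101 h111 a b ha0 ha1 hb0 hb1
  exact box1 (hf3 a b) hc₀ hc₁ c hc0 hc1

/-- **Four variables** (the cell shape of the region criterion: `(λ, λ', V, V')`). -/
theorem box4 {f : ℝ → ℝ → ℝ → ℝ → ℝ} (hf1 : ∀ b c d, ∃ p q : ℝ, ∀ t, f t b c d = p + q * t)
    (hf2 : ∀ a c d, ∃ p q : ℝ, ∀ t, f a t c d = p + q * t)
    (hf3 : ∀ a b d, ∃ p q : ℝ, ∀ t, f a b t d = p + q * t)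
    (hf4 : ∀ a b c, ∃ p q : ℝ, ∀ t, f a b c t = p + q * t) {a₀ a₁ b₀ b₁ c₀ c₁ d₀ d₁ : ℝ}
    (h0000 : 0 ≤ f a₀ b₀ c₀ d₀) (h0100 : 0 ≤ f a₀ b₁ c₀ d₀) (h1000 : 0 ≤ f a₁ b₀ c₀ d₀)
    (h1100 : 0 ≤ f a₁ b₁ c₀ d₀) (h0010 : 0 ≤ f a₀ b₀ c₁ d₀) (h0110 : 0 ≤ f a₀ b₁ c₁ d₀)
    (h1010 : 0 ≤ f a₁ b₀ c₁ d₀) (h1110 : 0 ≤ f a₁ b₁ c₁ d₀)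
    (h0001 : 0 ≤ f a₀ b₀ c₀ d₁) (h0101 : 0 ≤ f a₀ b₁ c₀ d₁) (h1001 : 0 ≤ f a₁ b₀ c₀ d₁)
    (h1101 : 0 ≤ f a₁ b₁ c₀ d₁) (h0011 : 0 ≤ f a₀ b₀ c₁ d₁) (h0111 : 0 ≤ f a₀ b₁ c₁ d₁)
    (h1011 : 0 ≤ f a₁ b₀ c₁ d₁) (h1111 : 0 ≤ f a₁ b₁ c₁ d₁) :
    ∀ a b c d, a₀ ≤ a → a ≤ a₁ → b₀ ≤ b → b ≤ b₁ → c₀ ≤ c → c ≤ c₁ → d₀ ≤ d → d ≤ d₁ →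
      0 ≤ f a b c d := by
  intro a b c d ha0 ha1 hb0 hb1 hc0 hc1 hd0 hd1
  have hd₀ : 0 ≤ f a b c d₀ :=
    box3 (fun b c => hf1 b c d₀) (fun a c => hf2 a c d₀) (fun a b => hf3 a b d₀)
      h0000 h0100 h1000 h1100 h0010 h0110 h1010 h1110 a b c ha0 ha1 hb0 hb1 hc0 hc1
  have hd₁ : 0 ≤ f a b c d₁ :=
    box3 (fun b c => hf1 b c d₁) (fun a c => hf2 a c d₁) (fun a b => hf3 a b d₁)
      h0001 h0101 h1001 h1101 h0011 h0111 h1011 h1111 a b c ha0 ha1 hb0 hb1 hc0 hc1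
  exact box1 (hf4 a b c) hd₀ hd₁ d hd0 hd1

/-! ## The criterion's cell expressions are multi-affine (the four affinity witnesses, once and for all) -/

/-- The endpoint expression of `cell_bound` as a function of the cell variables:
`E(λ, λ', V, V') = RHS − A·ca − B·cb` with `RHS = (λ+λ'−(2β−1)λλ')(ε+1) − [λ'(1−βλ)V' + λ(1−βλ')V + zλλ'VV']`,
`A = (1−(β−1)λ')λ(ε+1−V)`, `B = (1−(β−1)λ)λ'(ε+1−V')` (the product rule substituted for `V_P`). -/
def cellExpr (β z ε ca cb : ℝ) (lam lam' V V' : ℝ) : ℝ :=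
  (lam + lam' - (2 * β - 1) * lam * lam') * (ε + 1) -
      (lam' * (1 - β * lam) * V' + lam * (1 - β * lam') * V + z * lam * lam' * V * V') -
    (1 - (β - 1) * lam') * (lam * (ε + 1 - V)) * ca - (1 - (β - 1) * lam) * (lam' * (ε + 1 - V')) * cb

/-- `cellExpr` is affine in each of its four variables. -/
theorem cellExpr_affine (β z ε ca cb : ℝ) :
    (∀ b c d, ∃ p q : ℝ, ∀ t, cellExpr β z ε ca cb t b c d = p + q * t) ∧
    (∀ a c d, ∃ p q : ℝ, ∀ t, cellExpr β z ε ca cb a t c d = p + q * t) ∧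
    (∀ a b d, ∃ p q : ℝ, ∀ t, cellExpr β z ε ca cb a b t d = p + q * t) ∧
    (∀ a b c, ∃ p q : ℝ, ∀ t, cellExpr β z ε ca cb a b c t = p + q * t) := by
  refine ⟨fun b c d => affine_witness fun t => ?_, fun a c d => affine_witness fun t => ?_,
    fun a b d => affine_witness fun t => ?_, fun a b c => affine_witness fun t => ?_⟩ <;>
  simp only [cellExpr] <;> ring

/-- **Cell certificate.**  If `cellExpr β z ε ca cb ≥ 0` at the 16 vertices of a box then on the whole box the
endpoint inequality of `cell_bound` holds in the form `A·ca + B·cb ≤ RHS(V_P)` for every `V_P` satisfying the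
product rule. -/
theorem cell_of_vertices {β z ε ca cb a₀ a₁ b₀ b₁ c₀ c₁ d₀ d₁ : ℝ}
    (hv : ∀ a ∈ [a₀, a₁], ∀ b ∈ [b₀, b₁], ∀ c ∈ [c₀, c₁], ∀ d ∈ [d₀, d₁], 0 ≤ cellExpr β z ε ca cb a b c d)
    {lam lam' V V' VP : ℝ} (hl : a₀ ≤ lam ∧ lam ≤ a₁) (hl' : b₀ ≤ lam' ∧ lam' ≤ b₁)
    (hV : c₀ ≤ V ∧ V ≤ c₁) (hV' : d₀ ≤ V' ∧ V' ≤ d₁)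
    (hP : VP * (lam + lam' - (2 * β - 1) * lam * lam') =
      lam' * (1 - β * lam) * V' + lam * (1 - β * lam') * V + z * lam * lam' * V * V') :
    (1 - (β - 1) * lam') * (lam * (ε + 1 - V)) * ca + (1 - (β - 1) * lam) * (lam' * (ε + 1 - V')) * cb ≤
      (lam + lam' - (2 * β - 1) * lam * lam') * (ε + 1 - VP) := by
  obtain ⟨h1, h2, h3, h4⟩ := cellExpr_affine β z ε ca cb
  have hm : ∀ {x y u : ℝ}, u ∈ [x, y] ↔ u = x ∨ u = y := by intro x y u; simp
  have key := box4 h1 h2 h3 h4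
    (hv a₀ (by simp) b₀ (by simp) c₀ (by simp) d₀ (by simp)) (hv a₀ (by simp) b₁ (by simp) c₀ (by simp) d₀ (by simp))
    (hv a₁ (by simp) b₀ (by simp) c₀ (by simp) d₀ (by simp)) (hv a₁ (by simp) b₁ (by simp) c₀ (by simp) d₀ (by simp))
    (hv a₀ (by simp) b₀ (by simp) c₁ (by simp) d₀ (by simp)) (hv a₀ (by simp) b₁ (by simp) c₁ (by simp) d₀ (by simp))
    (hv a₁ (by simp) b₀ (by simp) c₁ (by simp) d₀ (by simp)) (hv a₁ (by simp) b₁ (by simp) c₁ (by simp) d₀ (by simp))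
    (hv a₀ (by simp) b₀ (by simp) c₀ (by simp) d₁ (by simp)) (hv a₀ (by simp) b₁ (by simp) c₀ (by simp) d₁ (by simp))
    (hv a₁ (by simp) b₀ (by simp) c₀ (by simp) d₁ (by simp)) (hv a₁ (by simp) b₁ (by simp) c₀ (by simp) d₁ (by simp))
    (hv a₀ (by simp) b₀ (by simp) c₁ (by simp) d₁ (by simp)) (hv a₀ (by simp) b₁ (by simp) c₁ (by simp) d₁ (by simp))
    (hv a₁ (by simp) b₀ (by simp) c₁ (by simp) d₁ (by simp)) (hv a₁ (by simp) b₁ (by simp) c₁ (by simp) d₁ (by simp))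
    lam lam' V V' hl.1 hl.2 hl'.1 hl'.2 hV.1 hV.2 hV'.1 hV'.2
  have e : cellExpr β z ε ca cb lam lam' V V' =
      (lam + lam' - (2 * β - 1) * lam * lam') * (ε + 1 - VP) -
        ((1 - (β - 1) * lam') * (lam * (ε + 1 - V)) * ca +
          (1 - (β - 1) * lam) * (lam' * (ε + 1 - V')) * cb) := by
    simp only [cellExpr]; linear_combination hP
  linarith [key, e]

end Summit.MatrixMultiplication.MatrixMultiplication.Theorems.FarEdgeDescentBoxVertex
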